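import Mathlib
import HarnessLib
import Summits.KontsevichZagierPeriods.KontsevichZagierPeriods.Theorems.LinRedNormalFormArrangementNormalFormStubIntegrateOutPole

/-!
# `stub_integrateOut` (line `janus-bands`), part 4: polynomial factor; band coordinates

* `IntegrateOut.flat_poly`: the analogue of `flat_pole` for an integrand `ratJ(x) · (y − ℓ)^n`
  (no pole: dissect by (largest lower bound, smallest upper bound) and apply `piece_stepP`).
* The coordinate relabelling `eqv : Fin (b + 1 + k) ≃ Fin (b + k + 1)` moving the distinguished
  base coordinate `y` of a `Gᵢ b k` representation to the last position, base rows solved for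
  `y` (`restr`, `nrm`, `row_iff`), padded affine data `pad` and coordinate forms `crd` on the
  flat coordinates `(x', t)`.

Registered sub-goal proved here: `integrateOut_flatPoly`.
[Kontsevich–Zagier 2001, §1.2, rules (1)–(3)]
-/

noncomputable section

open Set MeasureTheory
open Literature.NumberTheory.Transcendental
open Literature.ModelTheory.ExponentialFields

namespace Summit.KontsevichZagierPeriods.ArrangementNormalForm.JanusBands

namespace IntegrateOut

/-! ### Integrating out a coordinate carrying a polynomial factor -/

/-- **Integrating out the last coordinate when it carries a polynomial factor `(y − ℓ)^n`.**
Let `r₀` be a bounded representation on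
`{(x, y) | x ∈ poly ZRs, P(x) < y (P ∈ LWs), y < S(x) (S ∈ UPs)}` with integrand
`ratJ(x) · (y − ℓ(x))^n`. Then `[r₀]` is congruent modulo `KZ.relations` to a `ℤ`-combination
of elements of `JJ B 0`: dissect by "which lower bound is the largest, which upper bound the
smallest" (rule 1a; ties are null hyperplanes) and apply Newton–Leibniz along `y` with the
polynomial primitive on each piece (`piece_stepP`).
[Kontsevich–Zagier 2001, §1.2, rules (1), (3)] [folklore] -/
theorem flat_poly {B m : ℕ} (r₀ : KZ.IntegralRep (B + 1)) (ZRs LWs UPs : Finset ((Fin B → ℚ) × ℚ))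
    (L : Fin m → (Fin B → ℚ) × ℚ) (e : Fin m → ℕ) (p : MvPolynomial (Fin B) ℚ)
    (ℓ : (Fin B → ℚ) × ℚ) (n : ℕ)
    (hmem : ∀ w, w ∈ r₀.domain ↔ ((Fin.init w : Fin B → ℝ) ∈ poly B ZRs ∧
      (∀ P ∈ LWs, ev P (Fin.init w) < w (Fin.last B)) ∧
      ∀ S ∈ UPs, w (Fin.last B) < ev S (Fin.init w)))
    (hr₀i : EqOn r₀.integrand (intP B m L e p ℓ n) r₀.domain)
    (hr₀b : Bornology.IsBounded r₀.domain) :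
    ∃ c ∈ AddSubgroup.closure (JJ0 B), KZ.of r₀ - c ∈ KZ.relations := by
  classical
  set pc : ((Fin B → ℚ) × ℚ) × ((Fin B → ℚ) × ℚ) → Set (Fin (B + 1) → ℝ) :=
    fun idx => {w | (Fin.init w : Fin B → ℝ) ∈ poly B (rowsP₀ ZRs LWs UPs idx.1 idx.2) ∧
      ev idx.1 (Fin.init w) < w (Fin.last B) ∧ w (Fin.last B) < ev idx.2 (Fin.init w)}
    with hpc
  have hpcsa : ∀ idx, IsSemialgebraic ℚ (pc idx) := fun idx =>
    isSemialgebraic_openBand (isSemialgebraic_poly B _) idx.1 idx.2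
  have hpcsub : ∀ idx, pc idx ⊆ r₀.domain := by
    rintro ⟨P, S⟩ w ⟨hw, hPw, hwS⟩
    rw [mem_poly_rowsP₀] at hw
    obtain ⟨hcell, hLP, hUS, -⟩ := hw
    refine (hmem w).mpr ⟨hcell, fun P' hP' => ?_, fun S' hS' => ?_⟩
    · by_cases hne : P' = P
      · rw [hne]; exact hPw
      · exact (hLP P' hne hP').trans hPw
    · by_cases hne : S' = S
      · rw [hne]; exact hwS
      · exact hwS.trans (hUS S' hne hS')
  set R : ((Fin B → ℚ) × ℚ) × ((Fin B → ℚ) × ℚ) → KZ.IntegralRep (B + 1) :=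
    fun idx => r₀.restrict (pc idx) (hpcsa idx) (hpcsub idx) with hR
  set T : Finset (((Fin B → ℚ) × ℚ) × ((Fin B → ℚ) × ℚ)) := LWs ×ˢ UPs with hT
  have hstep : ∀ idx, ∃ r' : KZ.IntegralRep B,
      KZ.of (R idx) - KZ.of r' ∈ KZ.relations ∧ KZ.of r' ∈ JJ0 B := by
    rintro ⟨P, S⟩
    exact piece_stepP (rowsP₀ ZRs LWs UPs P S) L e p P S ℓ n
      (fun x hx => ((mem_poly_rowsP₀ _ _ _ P S x).mp hx).2.2.2) (R (P, S))
      (hr₀b.subset (hpcsub _)) rfl (hr₀i.mono (hpcsub _))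
  choose rr hrr using hstep
  have hxw : ∀ w : Fin (B + 1) → ℝ, (fun i => w (Fin.castSucc i)) = Fin.init w := fun w => rfl
  set Ties : Set (Fin (B + 1) → ℝ) :=
    (⋃ P ∈ LWs, ⋃ P' ∈ LWs.erase P,
      {w | MvPolynomial.aeval w (affPoly Fin.castSucc (P - P')) = 0}) ∪
    (⋃ S ∈ UPs, ⋃ S' ∈ UPs.erase S,
      {w | MvPolynomial.aeval w (affPoly Fin.castSucc (S - S')) = 0}) with hTies_def
  have hTies : volume Ties = 0 := by
    refine measure_union_null ?_ ?_ <;>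
      refine (measure_biUnion_null_iff (Finset.countable_toSet _)).mpr fun P _ =>
        (measure_biUnion_null_iff (Finset.countable_toSet _)).mpr fun P' hP' =>
          volume_aeval_null _ (affPoly_ne_zero (Fin.castSucc_injective B)
            (sub_ne_zero.mpr ?_)) <;>
      exact fun h => (Finset.mem_erase.mp hP').1 h.symm
  have hcov : r₀.domain \ (⋃ idx ∈ T, (R idx).domain) ⊆ Ties := by
    rintro w ⟨hw, hwU⟩
    obtain ⟨hLWne, hUPne⟩ := nonempty_bounds hr₀b LWs UPs ev ev (poly B ZRs) hmem hw
    obtain ⟨hcell, hlw, hup⟩ := (hmem w).mp hw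
    set xb : Fin B → ℝ := Fin.init w with hxb
    obtain ⟨P₀, hP₀, hP₀max⟩ := Finset.exists_max_image LWs (fun P => ev P xb) hLWne
    obtain ⟨S₀, hS₀, hS₀min⟩ := Finset.exists_min_image UPs (fun S => ev S xb) hUPne
    by_cases htP : ∃ P' ∈ LWs.erase P₀, ev P' xb = ev P₀ xb
    · obtain ⟨P', hP', hP'e⟩ := htP
      refine Or.inl ?_
      simp only [mem_iUnion]
      refine ⟨P₀, hP₀, P', hP', ?_⟩
      simp only [mem_setOf_eq, aeval_affPoly, ev_sub, hxw, ← hxb, hP'e, sub_self]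
    by_cases htS : ∃ S' ∈ UPs.erase S₀, ev S' xb = ev S₀ xb
    · obtain ⟨S', hS', hS'e⟩ := htS
      refine Or.inr ?_
      simp only [mem_iUnion]
      refine ⟨S₀, hS₀, S', hS', ?_⟩
      simp only [mem_setOf_eq, aeval_affPoly, ev_sub, hxw, ← hxb, hS'e, sub_self]
    push Not at htP htS
    have hLP : ∀ P', P' ≠ P₀ → P' ∈ LWs → ev P' xb < ev P₀ xb := fun P' hne hP' =>
      lt_of_le_of_ne (hP₀max P' hP') (htP P' (Finset.mem_erase.mpr ⟨hne, hP'⟩))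
    have hUS : ∀ S', S' ≠ S₀ → S' ∈ UPs → ev S₀ xb < ev S' xb := fun S' hne hS' =>
      lt_of_le_of_ne (hS₀min S' hS') (htS S' (Finset.mem_erase.mpr ⟨hne, hS'⟩)).symm
    have hpiece : w ∈ pc (P₀, S₀) :=
      ⟨(mem_poly_rowsP₀ _ _ _ P₀ S₀ _).mpr ⟨hcell, hLP, hUS, (hlw P₀ hP₀).trans (hup S₀ hS₀)⟩,
        hlw P₀ hP₀, hup S₀ hS₀⟩
    exact absurd (mem_iUnion₂.mpr ⟨(P₀, S₀), by simp [hT, hP₀, hS₀], hpiece⟩) hwU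
  have hdis : KZ.of r₀ - ∑ idx ∈ T, KZ.of (R idx) ∈ KZ.relations := by
    refine KZ.of_sub_sum_of_mem_relations T r₀ R (fun idx _ => ?_) (fun idx _ w _ => rfl)
      (measure_mono_null hcov hTies) ?_
    · rw [show (R idx).domain \ r₀.domain = ∅ from Set.sdiff_eq_empty.mpr (hpcsub idx),
        measure_empty]
    · intro idx hidx idx' hidx' hne
      rw [show (R idx).domain ∩ (R idx').domain = ∅ from ?_, measure_empty]
      obtain ⟨P, S⟩ := idx
      obtain ⟨P', S'⟩ := idx'
      simp only [hT, Finset.mem_coe, Finset.mem_product] at hidx hidx'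
      refine Set.eq_empty_of_forall_notMem fun w hw2 => ?_
      obtain ⟨⟨hw, -, -⟩, ⟨hw', -, -⟩⟩ := hw2
      rw [mem_poly_rowsP₀] at hw hw'
      obtain ⟨-, hLP, hUS, -⟩ := hw
      obtain ⟨-, hLP', hUS', -⟩ := hw'
      by_cases hP : P = P'
      · subst hP
        by_cases hS : S = S'
        · exact hne (by rw [hS])
        · exact lt_asymm (hUS S' (Ne.symm hS) hidx'.2) (hUS' S hS hidx.2)
      · exact lt_asymm (hLP P' (Ne.symm hP) hidx'.1) (hLP' P hP hidx.1)
  refine ⟨∑ idx ∈ T, KZ.of (rr idx),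
    AddSubgroup.sum_mem _ fun idx _ => AddSubgroup.subset_closure (hrr idx).2, ?_⟩
  have : KZ.of r₀ - ∑ idx ∈ T, KZ.of (rr idx) = (KZ.of r₀ - ∑ idx ∈ T, KZ.of (R idx)) +
      (∑ idx ∈ T, KZ.of (R idx) - ∑ idx ∈ T, KZ.of (rr idx)) := by abel
  rw [this]
  exact KZ.relations.add_mem hdis (KZ.sum_sub_sum_mem_relations T _ _ fun idx _ => (hrr idx).1)

/-! ### From `Gᵢ b k` coordinates (`y` in the middle) to flat band coordinates (`y` last) -/

/-- New position of the old coordinates: `x'ⱼ ↦ j`, `y ↦ b + k` (last), `tᵢ ↦ b + i`.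
[folklore] -/
def eqvFun (b k : ℕ) : Fin (b + 1 + k) → Fin (b + k + 1) :=
  Fin.addCases (fun i : Fin (b + 1) => Fin.lastCases (Fin.last (b + k))
    (fun j : Fin b => Fin.castSucc (Fin.castAdd k j)) i)
    (fun i : Fin k => Fin.castSucc (Fin.natAdd b i))

/-- Old position of the new coordinates (inverse of `eqvFun`). [folklore] -/
def eqvInv (b k : ℕ) : Fin (b + k + 1) → Fin (b + 1 + k) :=
  Fin.lastCases (Fin.castAdd k (Fin.last b)) (Fin.addCases
    (fun j : Fin b => Fin.castAdd k (Fin.castSucc j)) (fun i : Fin k => Fin.natAdd (b + 1) i))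

/-- The coordinate relabelling `Fin (b + 1 + k) ≃ Fin (b + k + 1)` moving `y` (index `b`) to the
last position. [folklore] -/
def eqv (b k : ℕ) : Fin (b + 1 + k) ≃ Fin (b + k + 1) where
  toFun := eqvFun b k
  invFun := eqvInv b k
  left_inv i := by
    refine Fin.addCases (fun i => ?_) (fun i => ?_) i
    · refine Fin.lastCases ?_ (fun j => ?_) i
      · simp only [eqvFun, eqvInv, Fin.addCases_left, Fin.lastCases_last]
      · simp only [eqvFun, eqvInv, Fin.addCases_left, Fin.lastCases_castSucc]
    · simp only [eqvFun, eqvInv, Fin.addCases_right, Fin.lastCases_castSucc]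
  right_inv j := by
    refine Fin.lastCases ?_ (fun j => ?_) j
    · simp only [eqvFun, eqvInv, Fin.addCases_left, Fin.lastCases_last]
    · refine Fin.addCases (fun i => ?_) (fun i => ?_) j
      · simp only [eqvFun, eqvInv, Fin.addCases_left, Fin.lastCases_castSucc]
      · simp only [eqvFun, eqvInv, Fin.addCases_right, Fin.lastCases_castSucc]

/-- `eqv` on a base coordinate `x'ⱼ`. [folklore] -/
@[simp] theorem eqv_x (b k : ℕ) (j : Fin b) :
    eqv b k (Fin.castAdd k (Fin.castSucc j)) = Fin.castSucc (Fin.castAdd k j) := by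
  simp [eqv, eqvFun]

/-- `eqv` on the distinguished coordinate `y`. [folklore] -/
@[simp] theorem eqv_y (b k : ℕ) : eqv b k (Fin.castAdd k (Fin.last b)) = Fin.last (b + k) := by
  simp [eqv, eqvFun]

/-- `eqv` on a fibre coordinate `tᵢ`. [folklore] -/
@[simp] theorem eqv_t (b k : ℕ) (i : Fin k) :
    eqv b k (Fin.natAdd (b + 1) i) = Fin.castSucc (Fin.natAdd b i) := by
  simp [eqv, eqvFun]

/-- Forgetting the `y`-coefficient of an affine datum over `Fin (b + 1)`. [folklore] -/
def restr {b : ℕ} (c : (Fin (b + 1) → ℚ) × ℚ) : (Fin b → ℚ) × ℚ :=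
  (fun j => c.1 (Fin.castSucc j), c.2)

/-- A base row solved for `y`: `−(restr c) / c_y`. [folklore] -/
def nrm {b : ℕ} (c : (Fin (b + 1) → ℚ) × ℚ) : (Fin b → ℚ) × ℚ :=
  (-(c.1 (Fin.last b))⁻¹) • restr c

/-- Splitting off the `y`-term of an affine datum over `Fin (b + 1)`. [folklore] -/
theorem ev_succ {b : ℕ} (c : (Fin (b + 1) → ℚ) × ℚ) (v : Fin (b + 1) → ℝ) :
    ev c v = ev (restr c) (fun j => v (Fin.castSucc j)) +
      (c.1 (Fin.last b) : ℝ) * v (Fin.last b) := by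
  simp only [ev, restr, Fin.sum_univ_castSucc]
  ring

/-- A `y`-free affine datum evaluates through `restr`. [folklore] -/
theorem ev_of_last_eq_zero {b : ℕ} (c : (Fin (b + 1) → ℚ) × ℚ) (hc : c.1 (Fin.last b) = 0)
    (v : Fin (b + 1) → ℝ) : ev c v = ev (restr c) (fun j => v (Fin.castSucc j)) := by
  rw [ev_succ, hc, Rat.cast_zero, zero_mul, add_zero]

/-- One base row, solved for `y` according to the sign of its `y`-coefficient. [folklore] -/
theorem row_iff {b : ℕ} (c : (Fin (b + 1) → ℚ) × ℚ) (v : Fin (b + 1) → ℝ) :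
    0 < ev c v ↔
      ((c.1 (Fin.last b) = 0 → 0 < ev (restr c) (fun j => v (Fin.castSucc j))) ∧
       (0 < c.1 (Fin.last b) → ev (nrm c) (fun j => v (Fin.castSucc j)) < v (Fin.last b)) ∧
       (c.1 (Fin.last b) < 0 → v (Fin.last b) < ev (nrm c) (fun j => v (Fin.castSucc j)))) := by
  rw [ev_succ]
  set E := ev (restr c) (fun j => v (Fin.castSucc j))
  set μ := c.1 (Fin.last b) with hμ
  set y := v (Fin.last b)
  have hn : ev (nrm c) (fun j => v (Fin.castSucc j)) = -(μ : ℝ)⁻¹ * E := by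
    simp only [nrm, ev_smul, Rat.cast_neg, Rat.cast_inv, E, hμ]
  rw [hn]
  rcases lt_trichotomy μ 0 with h | h | h
  · have h' : (μ : ℝ) < 0 := by exact_mod_cast h
    have hpos : (0 : ℝ) < -(μ : ℝ)⁻¹ := by simpa using inv_lt_zero.mpr h'
    have hid : (-(μ : ℝ)⁻¹) * (E + μ * y) = -(μ : ℝ)⁻¹ * E - y := by
      rw [show (-(μ : ℝ)⁻¹) * (E + μ * y) = -(μ : ℝ)⁻¹ * E - ((μ : ℝ)⁻¹ * μ) * y by ring,
        inv_mul_cancel₀ h'.ne, one_mul]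
    have key : 0 < E + (μ : ℝ) * y ↔ y < -(μ : ℝ)⁻¹ * E :=
      (mul_pos_iff_of_pos_left hpos).symm.trans (by rw [hid, sub_pos])
    simp [h.ne, h.not_gt, h, key]
  · simp [h]
  · have h' : (0 : ℝ) < μ := by exact_mod_cast h
    have hpos : (0 : ℝ) < (μ : ℝ)⁻¹ := inv_pos.mpr h'
    have hid : (μ : ℝ)⁻¹ * (E + μ * y) = y - -(μ : ℝ)⁻¹ * E := by
      rw [show (μ : ℝ)⁻¹ * (E + μ * y) = ((μ : ℝ)⁻¹ * μ) * y - -(μ : ℝ)⁻¹ * E by ring,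
        inv_mul_cancel₀ h'.ne', one_mul]
    have key : 0 < E + (μ : ℝ) * y ↔ -(μ : ℝ)⁻¹ * E < y :=
      (mul_pos_iff_of_pos_left hpos).symm.trans (by rw [hid, sub_pos])
    simp [h.ne', h.not_gt, h, key]

/-- Padding an affine datum over the base `Fin b` by zero coefficients on `k` further
coordinates. [folklore] -/
def pad {b : ℕ} (k : ℕ) (c : (Fin b → ℚ) × ℚ) : (Fin (b + k) → ℚ) × ℚ := (Fin.append c.1 0, c.2)

/-- A padded datum evaluates through the first `b` coordinates. [folklore] -/
@[simp] theorem ev_pad {b k : ℕ} (c : (Fin b → ℚ) × ℚ) (v : Fin (b + k) → ℝ) :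
    ev (pad k c) v = ev c (fun i => v (Fin.castAdd k i)) := by
  simp [ev, pad, Fin.sum_univ_add]

/-- The coordinate form of the `i`-th of the last `k` coordinates. [folklore] -/
def crd (b : ℕ) {k : ℕ} (i : Fin k) : (Fin (b + k) → ℚ) × ℚ := (Pi.single (Fin.natAdd b i) 1, 0)

/-- The coordinate form evaluates to the coordinate. [folklore] -/
@[simp] theorem ev_crd {b k : ℕ} (i : Fin k) (v : Fin (b + k) → ℝ) :
    ev (crd b i) v = v (Fin.natAdd b i) := by
  simp [ev, crd, Pi.single_apply, apply_ite (Rat.cast : ℚ → ℝ), ite_mul]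

end IntegrateOut

open IntegrateOut in
/-- **Integrating out a coordinate carrying a polynomial factor over a rational polytope**
(registered sub-goal of `stub_integrateOut`, part 4): `IntegrateOut.flat_poly` restated. -/
theorem integrateOut_flatPoly (B m n : ℕ) (r₀ : KZ.IntegralRep (B + 1)) (ZRs LWs UPs : Finset ((Fin B → ℚ) × ℚ)) (L : Fin m → (Fin B → ℚ) × ℚ) (e : Fin m → ℕ) (p : MvPolynomial (Fin B) ℚ) (ℓ : (Fin B → ℚ) × ℚ) (hmem : ∀ w, w ∈ r₀.domain ↔ ((Fin.init w : Fin B → ℝ) ∈ IntegrateOut.poly B ZRs ∧ (∀ P ∈ LWs, IntegrateOut.ev P (Fin.init w) < w (Fin.last B)) ∧ ∀ S ∈ UPs, w (Fin.last B) < IntegrateOut.ev S (Fin.init w))) (hr₀i : Set.EqOn r₀.integrand (IntegrateOut.intP B m L e p ℓ n) r₀.domain) (hr₀b : Bornology.IsBounded r₀.domain) : ∃ c ∈ AddSubgroup.closure (IntegrateOut.JJ0 B), KZ.of r₀ - c ∈ KZ.relations :=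
  flat_poly r₀ ZRs LWs UPs L e p ℓ n hmem hr₀i hr₀b

end Summit.KontsevichZagierPeriods.ArrangementNormalForm.JanusBands
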